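import Summits.QuantumFields.QCD.Theorems.QuarksAsStableActionStableActionBridgeDefs
import Summits.QuantumFields.QCD.Theorems.QuarksAsStableActionStableActionBridgeSoftClosureQCD
import HarnessLib

/-!
# Soft OS closure IV: `QCDOf N_f` from the CANONICAL lattice package (read on `qcdLatticeDist`) + the rotation module

Support file for crux `QuarksAsStableAction.StableActionBridge` (item stmt-QuantumFields-9737), line `Sketch`
(reshape r3c): `qcdOf_of_canonicalPackage` = `qcdOf_of_package` with the labelled functionals instantiated to the
lattice `n`-point distributions `k ↦ qcdLatticeDist (reg.scheme m z shift) k` (file `…Defs`); agreement with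
`qcdLatticeSchwinger` on real tensors and degree-`0` normalisation are the theorems
`qcdLatticeSchwinger_eq_qcdLatticeDist`, `qcdLatticeDist_zero_apply`, so the package keeps only the k-uniform E0′
bound, convergence on `⁰𝒮`, asymptotic translation / permutation symmetry, eventually approximately positive OS
forms, k-uniform spatial clustering, species CS clustering + uniform lattice gap, and the three non-vanishing
witnesses.  This is the composition theorem of the registered skeleton (`StableActionBridge_of`).
References: Osterwalder–Schrader II (1975) §2, §4; Glimm–Jaffe 1987 §6.1.
-/

noncomputable section

open Filter Topology ComplexConjugate
open scoped SchwartzMap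
open Literature.MathematicalPhysics.AQFT Literature.MathematicalPhysics.QuantumLattice
open Literature.MathematicalPhysics.QuantumFieldTheory

namespace Summit.QuantumFields.QCD.Cruxes.StableActionBridge.Sketch

/-- **E0-normalisation of the canonical lattice distributions, exactly at every `k`**: the labelled family
`n ↦ qcdLatticeDist sch k n` is normalised (`𝔖₀ = 1`), because degree `0` is point evaluation by construction. [folklore] -/
theorem isNormalized_qcdLatticeDist :
    ∀ {Nf : ℕ} (sch : QCDScheme Nf) (k : ℕ), LabelledSchwingerFamily.IsNormalized (qcdLatticeDist sch k) :=
  fun sch k σ F => (qcdLatticeDist_zero_apply sch k σ F).trans (congrArg F (Subsingleton.elim _ _))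

/-- **`QCDOf N_f` from the CANONICAL lattice package and the rotation module.**  As `qcdOf_of_package`, with the sequence of
labelled functionals instantiated to the lattice `n`-point distributions `k ↦ qcdLatticeDist (reg.scheme m z shift) k` of the
scheme: the agreement with `qcdLatticeSchwinger` on real tensors and the degree-`0` normalisation are theorems
(`qcdLatticeSchwinger_eq_qcdLatticeDist`, `qcdLatticeDist_zero_apply`), so the package consists only of the k-uniform E0′ bound,
convergence on `⁰𝒮`, asymptotic translation / permutation symmetry, eventually approximately positive OS forms, k-uniform spatial
clustering, species CS clustering + the uniform lattice gap at one rate, and the three non-vanishing witnesses.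
[cite: OsterwalderSchraderCMP1975, §2, §4] -/
theorem qcdOf_of_canonicalPackage :
    ∀ {Nf : ℕ},
    (∃ reg : QCDRegularisation Nf, reg.HasMassScaling ∧ reg.IsChiralAtZero ∧
      ∀ m : Fin Nf → ℝ, (∀ f, 0 < m f) → ∃ (z shift : QCDField Nf → ℕ → ℝ),
        (reg.scheme m z shift).HasAsymptoticScaling ∧
        (∀ fl : Fin Nf, ∀ᶠ k in atTop, -1 < (reg.scheme m z shift).mq fl k) ∧
        (∃ (s : ℕ) (α β : ℝ), 0 ≤ α ∧ ∀ (n : ℕ) (σ : Fin n → QCDField Nf), ∀ᶠ k in atTop,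
          ∀ F : 𝓢((Fin n → (EuclideanSpace ℝ (Fin 4))), ℂ), IsOffDiagonal F →
            ‖qcdLatticeDist (reg.scheme m z shift) k n σ F‖ ≤ α * (n.factorial : ℝ) ^ β * schwartzNorm (n * s) F) ∧
        (∀ (n : ℕ) (σ : Fin n → QCDField Nf) (F : 𝓢((Fin n → (EuclideanSpace ℝ (Fin 4))), ℂ)), IsOffDiagonal F →
          ∃ c : ℂ, Tendsto (fun k => qcdLatticeDist (reg.scheme m z shift) k n σ F) atTop (𝓝 c)) ∧
        (∀ (n : ℕ) (σ : Fin n → QCDField Nf) (a : (EuclideanSpace ℝ (Fin 4))) (F : 𝓢((Fin n → (EuclideanSpace ℝ (Fin 4))), ℂ)), IsOffDiagonal F →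
          Tendsto (fun k => qcdLatticeDist (reg.scheme m z shift) k n σ (translateMulti a F) -
            qcdLatticeDist (reg.scheme m z shift) k n σ F) atTop (𝓝 0)) ∧
        (∀ (n : ℕ) (σ : Fin n → QCDField Nf) (π : Equiv.Perm (Fin n)) (F : 𝓢((Fin n → (EuclideanSpace ℝ (Fin 4))), ℂ)),
          IsOffDiagonal F →
          Tendsto (fun k => qcdLatticeDist (reg.scheme m z shift) k n σ (permTest π F) -
            qcdLatticeDist (reg.scheme m z shift) k n (σ ∘ π) F) atTop (𝓝 0)) ∧
        (∀ (N : ℕ) (deg : Fin N → ℕ) (lab : (j : Fin N) → Fin (deg j) → QCDField Nf)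
          (F : (j : Fin N) → 𝓢((Fin (deg j) → (EuclideanSpace ℝ (Fin 4))), ℂ)), (∀ j, IsTimeOrdered (F j)) →
          ∀ H : (i j : Fin N) → 𝓢((Fin (deg i + deg j) → (EuclideanSpace ℝ (Fin 4))), ℂ),
            (∀ i j, IsAppendTensorOf (H i j) (osAdjoint (F i)) (F j)) →
            ∀ ε : ℝ, 0 < ε → ∀ᶠ l in atTop,
              -ε ≤ (∑ i, ∑ j, qcdLatticeDist (reg.scheme m z shift) l (deg i + deg j)
                (Fin.append (lab i ∘ Fin.rev) (lab j)) (H i j)).re ∧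
              |(∑ i, ∑ j, qcdLatticeDist (reg.scheme m z shift) l (deg i + deg j)
                (Fin.append (lab i ∘ Fin.rev) (lab j)) (H i j)).im| ≤ ε) ∧
        (∀ (n n' : ℕ) (σ : Fin n → QCDField Nf) (σ' : Fin n' → QCDField Nf) (F : 𝓢((Fin n → (EuclideanSpace ℝ (Fin 4))), ℂ))
          (G : 𝓢((Fin n' → (EuclideanSpace ℝ (Fin 4))), ℂ)), IsTimeOrdered F → IsTimeOrdered G → ∀ a : (EuclideanSpace ℝ (Fin 4)), a 0 = 0 → a ≠ 0 →
          ∀ ε : ℝ, 0 < ε → ∃ t₀ : ℝ, ∀ t : ℝ, t₀ ≤ t → ∀ H : 𝓢((Fin (n + n') → (EuclideanSpace ℝ (Fin 4))), ℂ),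
            IsAppendTensorOf H (osAdjoint F) (translateMulti (t • a) G) →
            ∀ᶠ k in atTop, ‖qcdLatticeDist (reg.scheme m z shift) k (n + n') (Fin.append (σ ∘ Fin.rev) σ') H -
              qcdLatticeDist (reg.scheme m z shift) k n (σ ∘ Fin.rev) (osAdjoint F) *
                qcdLatticeDist (reg.scheme m z shift) k n' σ' G‖ ≤ ε) ∧
        (∃ Δ : ℝ, 0 < Δ ∧ (reg.scheme m z shift).HasSpeciesCSClustering Δ ∧
          (reg.scheme m z shift).HasLatticeMassGap Δ) ∧
        (∃ (F G : 𝓢((Fin 1 → (EuclideanSpace ℝ (Fin 4))), ℂ)) (H : 𝓢((Fin (1 + 1) → (EuclideanSpace ℝ (Fin 4))), ℂ)),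
          IsTimeOrdered F ∧ IsTimeOrdered G ∧ IsAppendTensorOf H (osAdjoint F) G ∧ ∃ ε : ℝ, 0 < ε ∧
            ∀ᶠ k in atTop, ε ≤ ‖qcdLatticeDist (reg.scheme m z shift) k (1 + 1) (fun _ => QCDField.glue) H -
              qcdLatticeDist (reg.scheme m z shift) k 1 (fun _ => QCDField.glue) (osAdjoint F) *
                qcdLatticeDist (reg.scheme m z shift) k 1 (fun _ => QCDField.glue) G‖) ∧
        (∀ f g : Fin Nf, f ≠ g → ∃ (F G : 𝓢((Fin 1 → (EuclideanSpace ℝ (Fin 4))), ℂ)) (H : 𝓢((Fin (1 + 1) → (EuclideanSpace ℝ (Fin 4))), ℂ)),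
          IsTimeOrdered F ∧ IsTimeOrdered G ∧ IsAppendTensorOf H (osAdjoint F) G ∧ ∃ ε : ℝ, 0 < ε ∧
            ∀ᶠ k in atTop, ε ≤ ‖qcdLatticeDist (reg.scheme m z shift) k (1 + 1) (fun _ => QCDField.pseudoRe f g) H -
              qcdLatticeDist (reg.scheme m z shift) k 1 (fun _ => QCDField.pseudoRe f g) (osAdjoint F) *
                qcdLatticeDist (reg.scheme m z shift) k 1 (fun _ => QCDField.pseudoRe f g) G‖) ∧
        (∃ (f g h : 𝓢(EuclideanSpace ℝ (Fin 4), ℂ)) (Ffgh : 𝓢((Fin 3 → (EuclideanSpace ℝ (Fin 4))), ℂ)) (Fgh Ffh Ffg : 𝓢((Fin 2 → (EuclideanSpace ℝ (Fin 4))), ℂ))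
          (Ff Fg Fh : 𝓢((Fin 1 → (EuclideanSpace ℝ (Fin 4))), ℂ)),
          IsTensorOf Ffgh ![f, g, h] ∧ IsOffDiagonal Ffgh ∧ IsTensorOf Fgh ![g, h] ∧ IsTensorOf Ffh ![f, h] ∧
          IsTensorOf Ffg ![f, g] ∧ IsOffDiagonal Fgh ∧ IsOffDiagonal Ffh ∧ IsOffDiagonal Ffg ∧
          IsTensorOf Ff ![f] ∧ IsTensorOf Fg ![g] ∧ IsTensorOf Fh ![h] ∧ ∃ ε : ℝ, 0 < ε ∧
            ∀ᶠ k in atTop, ε ≤ ‖qcdLatticeDist (reg.scheme m z shift) k 3 (fun _ => QCDField.glue) Ffgh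
              - qcdLatticeDist (reg.scheme m z shift) k 1 (fun _ => QCDField.glue) Ff *
                  qcdLatticeDist (reg.scheme m z shift) k 2 (fun _ => QCDField.glue) Fgh
              - qcdLatticeDist (reg.scheme m z shift) k 1 (fun _ => QCDField.glue) Fg *
                  qcdLatticeDist (reg.scheme m z shift) k 2 (fun _ => QCDField.glue) Ffh
              - qcdLatticeDist (reg.scheme m z shift) k 1 (fun _ => QCDField.glue) Fh *
                  qcdLatticeDist (reg.scheme m z shift) k 2 (fun _ => QCDField.glue) Ffg
              + 2 * (qcdLatticeDist (reg.scheme m z shift) k 1 (fun _ => QCDField.glue) Ff *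
                  qcdLatticeDist (reg.scheme m z shift) k 1 (fun _ => QCDField.glue) Fg *
                  qcdLatticeDist (reg.scheme m z shift) k 1 (fun _ => QCDField.glue) Fh)‖)) →
    (∀ sch : QCDScheme Nf, sch.HasAsymptoticScaling →
      (∀ fl : Fin Nf, ∀ᶠ k in atTop, -1 < sch.mq fl k) → (∃ Δ : ℝ, 0 < Δ ∧ sch.HasLatticeMassGap Δ) →
      ∀ S : LabelledSchwingerFamily (QCDField Nf) (EuclideanSpace ℝ (Fin 4)),
        (∀ n : ℕ, n ≠ 0 → ∀ (σ : Fin n → QCDField Nf) (f : Fin n → 𝓢(EuclideanSpace ℝ (Fin 4), ℝ)) (F : 𝓢((Fin n → (EuclideanSpace ℝ (Fin 4))), ℂ)),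
          IsTensorOf F (fun i => ofRealTest (f i)) → IsOffDiagonal F →
          Tendsto (fun k => qcdLatticeSchwinger sch k n σ f) atTop (𝓝 (S n σ F))) →
        ∀ (n : ℕ) (σ : Fin n → QCDField Nf) (R : (EuclideanSpace ℝ (Fin 4)) ≃ₗᵢ[ℝ] (EuclideanSpace ℝ (Fin 4))),
          LinearMap.det (R.toLinearEquiv : (EuclideanSpace ℝ (Fin 4)) →ₗ[ℝ] (EuclideanSpace ℝ (Fin 4))) = 1 →
          ∀ F : 𝓢((Fin n → (EuclideanSpace ℝ (Fin 4))), ℂ), IsOffDiagonal F → S n σ (linActMulti R F) = S n σ F) →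
    QCDOf Nf := by
  intro Nf hpkg hrot
  refine qcdOf_of_package ?_ hrot
  obtain ⟨reg, hms, hχ, hall⟩ := hpkg
  refine ⟨reg, hms, hχ, fun m hm => ?_⟩
  obtain ⟨z, shift, hAS, hbr, hbound, hconv, htrans, hsymm, hrp, hcl, hgap, hglue, hpseudo, hκ₃⟩ := hall m hm
  refine ⟨z, shift, fun k => qcdLatticeDist (reg.scheme m z shift) k, ?_, hAS, hbr, hbound, hconv, ?_, htrans, hsymm,
    hrp, hcl, hgap, hglue, hpseudo, hκ₃⟩
  · intro k n hn σ f F hF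
    exact qcdLatticeSchwinger_eq_qcdLatticeDist (reg.scheme m z shift) k n hn σ f F hF
  · exact Eventually.of_forall fun k => isNormalized_qcdLatticeDist (reg.scheme m z shift) k

end Summit.QuantumFields.QCD.Cruxes.StableActionBridge.Sketch

end
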